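import Literature.MathematicalPhysics.QuantumFieldTheory.Balaban1983to89.B9Eq383QSemiLocal
import Literature.MathematicalPhysics.QuantumFieldTheory.Balaban1983to89.B9Eq333ProjectionCovariance

/-!
# `Balaban1983to89.B9Eq383QTorusBackgroundLocality` — T. Bałaban, *Propagators for lattice gauge theories in a background field*, Commun. Math. Phys.
# **99** (1985) 389–434 [Balaban1985BackgroundPropagators] (3.15) p. 393, (3.83) p. 407, Cor. 3.6 p. 408 and *Averaging operations for lattice gauge
# theories* [Balaban1985Averaging] (121)–(122) p. 36, p. 24: **THE ONE-STEP VECTOR AVERAGING `Q(U)` READS THE BACKGROUND ONLY ON THE TWO BLOCKS OF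
# THE COARSE BOND — so on a bond field supported over the blocks of a cube `Y` it reads `U` only over the 1-neighbourhood of `Y`: `Q(U)f = Q(Ũ)f` whenever
# `U = Ũ` there** — the `Q`-locality letter that ne9-leaf-05 g78's (K8) `B9Eq387CubeProjectionLocality` leaves open («the ONE remaining locality letter of the
# bond form») and that this lineage's per-cube gauge reduction `B9Eq387CubeReductionSmallField.cube_estimate_of_gauge_reduction` displays inside its `hQ`
# transfer letter; route R2′ STEP B8′, instance-ledger row L10 (loc) of the pub-balaban NE9 chain (`t4/ROUTES-NE9.md` v13.45)

statement-level skeleton of published theorems with citation tags; proofs where landed; nothing here is a claim about the Yang–Mills mass gap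

CITATION HEADER (lean-in-tree rule).  Audit cell `pub-balaban`, sub-cell `t4`, BINDER row NE9; filed by NE9 formalisation-swarm LEAF PROVER 06
(`b2b-balaban-t4-ne9-formalise-leaf-06`, gen 72), as a COMPOSITION BY NAME of the cell's objects: `B7LocalityGeneral.Qcov_congr` ([B7] (121)'s kernel locality
IN THE BACKGROUND AND IN THE FIELD, the OWNER∕B7 lineage), `B9Eq315QTorus.QtorusLin_apply ∕ QtorusW_apply` ((3.15) on the torus), and
`B9Eq383QSemiLocal.blockCoord_perSite_of_inBox` (the box of `Qcov_congr` read on the torus — the device of its `QtorusLin_congr_local`, which is the FIELD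
half of the same locality); §4 also ne9-leaf-03 g60's (3.32) `B9Eq333ProjectionCovariance.QtorusW_gaugeU ∕ hU1_gaugeU ∕ hreg_gaugeU` and
`B9Eq328GaugeAction.norm_gaugeW`.  CONSUMER BY SHAPE: the agreement letter is (K8)'s `hUŨ : ∀ b, (∃ y ∈ Y, tdist m y (blockCoord L m (bpos b)) ≤ 1) → U b = Ũ b`
verbatim.  Source READ in the held text: [Balaban1985BackgroundPropagators] p. 393 (3.15) *«Q(U) … defined by the averaging operation of [3]»*, p. 407 (3.83),
p. 408 Cor. 3.6; [Balaban1985Averaging] p. 36 (121)–(122), p. 24 (the block `B(c₋) ∪ B(c₊)`).  [folklore] bookkeeping; NOTHING of print's estimates asserted.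

WHAT IS PROVED (sorry-free; proof lane — no `def`; [folklore]).
* §1 **`QtorusLin_congr_of_background`** — if `U b = Ũ b` on every fine bond whose base block is `c₋`'s block or `c₊`'s block, then
  `(Q(U)A)(c) = (Q(Ũ)A)(c)` for EVERY `A` and WHATEVER regularity witnesses are carried on the two sides (they do not enter the value).
* §2 **`QtorusLin_eq_zero_of_vanish`** — if `A` vanishes on those bonds, `(Q(U)A)(c) = 0`.
* §3 **`QtorusW_congr_of_support`** — on the weighted `L²` carriers: for a bond field `f` supported over the blocks of `Y` and backgrounds with `U = Ũ` on
  every bond whose base block is within coarse distance `1` of `Y` ((K8)'s letter): `QtorusW … U … f = QtorusW … Ũ … f`; **`norm_QtorusW_congr_of_support`**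
  — the norm form.
* §4 **`norm_QtorusW_gauge_transfer`** — §3 at `(U^g, Ũ)` + (3.32) `QtorusW_gaugeU` + the isometry of `R(g)` on the coarse bonds: for a cube field `A`
  supported over the blocks of `Y`, a gauge function `g` with `g(x) ∈ U1` and fibrewise-isometric `R(g(x))`, and `U^g = Ũ` over the 1-neighbourhood of `Y`:
  `‖√a·Q(Ũ)(R(g)A)‖ = ‖√a·Q(U)A‖` — EXACTLY the `hQ` letter of this lineage's `B9Eq387CubeReductionSmallField.cube_estimate_of_gauge_reduction` (as `≤`).
HONEST SCOPE.  Equalities only; no smallness, no window, no estimate; the regularity witnesses (`hα1`, `hU1`, `hreg`) of BOTH backgrounds are displayed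
because `QtorusW` carries them as data; `m_i ≥ 1`.  NOT NE9 (cell pub-balaban: NE9 NOT PRINTED ∕ NOT PROVED; «NE9 ⇐ the named binders»; row WALLED ON A MODEL
(O-NE9-1; #5 UNRULED); spine PROVED 0∕9; rung (B)+1 on a finite T⁴ — NOT infinite volume, NOT mass gap, NOT BetaPertH, NOT Clay; HONEST DEPENDENCY: continuum YM
on T⁴ ⇐ BetaPertH ∧ nine spine estimates (0/9 proved); BetaPertH ⇐ (D1) ∧ (D4) ∧ CAP+tail; G-an2-4 gates asym, D1 and NE2/3/4).  NEW file; nothing modified.  Net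
new unproved facts: 0.
-/

noncomputable section

set_option autoImplicit false

open scoped BigOperators InnerProductSpace

namespace Literature.MathematicalPhysics.QuantumFieldTheory.Balaban1983to89.B9Eq383QTorusBackgroundLocality

open B4Sect5Torus (TSite tdist tdist_self)
open B9SectCLatticeCarrier (Bond bpos shift tdist_shift_le tdist_shift_le')
open B7Prop1Explicit (U1 Wcx boxVec)
open B7Prop1Local (InBox AgreeOn bondHi)
open B7Prop3GeneralLinear (linQcov Qcov)
open B7LocalityGeneral (Qcov_congr)
open B9Eq319QprimeTorus (fineP blockCoord)
open B9Eq311L2Pairing (WL2)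
open B11Eq103H1Complex (BondL2K)
open B9Eq315QTorus (perCfg perSite cornerSite QtorusLin QtorusLin_apply QtorusW QtorusW_apply)
open B9Eq383QSemiLocal (blockCoord_perSite_of_inBox QtorusLin_congr_local)
open B9Eq319QprimeTorus (centre)
open B9Eq328GaugeAction (gaugeU gaugeW AdW norm_gaugeW)
open B9Eq333ProjectionCovariance (QtorusW_gaugeU hU1_gaugeU hreg_gaugeU)

variable {d : ℕ} (L : ℕ) (m : Fin d → ℕ) [∀ i, NeZero (fineP L m i)]

/-! ## §1–§2 `(Q(U)A)(c)` reads `U` and `A` on the blocks `B(c₋)`, `B(c₊)` only -/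

section Lin

variable {𝔸 : Type*} [NormedRing 𝔸] [NormedAlgebra ℂ 𝔸] [CompleteSpace 𝔸] [NormOneClass 𝔸] (hL : 1 ≤ L)
  (U Ũ : Bond d (fineP L m) → 𝔸ˣ) {α α' : ℝ} (hα1 : α ≤ 1 / 64) (hα1' : α' ≤ 1 / 64)
  (hU1 : ∀ (x : B7Prop1Explicit.Site d) (κ : Fin d), perCfg (fineP L m) U x κ ∈ U1 𝔸)
  (hreg : ∀ (y : TSite d m) (κ : Fin d) (r : Fin d → Fin L),
    ‖((Wcx L (perCfg (fineP L m) U) (cornerSite L y) κ (boxVec L r) : 𝔸ˣ) : 𝔸) - 1‖ ≤ α)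
  (hU1' : ∀ (x : B7Prop1Explicit.Site d) (κ : Fin d), perCfg (fineP L m) Ũ x κ ∈ U1 𝔸)
  (hreg' : ∀ (y : TSite d m) (κ : Fin d) (r : Fin d → Fin L),
    ‖((Wcx L (perCfg (fineP L m) Ũ) (cornerSite L y) κ (boxVec L r) : 𝔸ˣ) : 𝔸) - 1‖ ≤ α')

/-- **`(Q(U)A)(c) = (Q(Ũ)A)(c)` WHEN `U = Ũ` ON THE FINE BONDS OF `B(c₋) ∪ B(c₊)`** — [B7] (121)'s kernel locality `Qcov_congr` in the BACKGROUND slot,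
carried through the `t`-derivative (122) and the periodic extension; the regularity witnesses of the two sides do not enter the value.
[folklore] [cite: Balaban1985Averaging, (121)–(122) p.36, p.24; Balaban1985BackgroundPropagators, (3.15) p.393, Cor 3.6 p.408] -/
theorem QtorusLin_congr_of_background (A : Bond d (fineP L m) → 𝔸) (c : Bond d m)
    (h : ∀ b : Bond d (fineP L m), (blockCoord L m b.1 = c.1 ∨ blockCoord L m b.1 = shift c.2 c.1) → U b = Ũ b) :
    QtorusLin L m hL U hα1 hU1 hreg A c = QtorusLin L m hL Ũ hα1' hU1' hreg' A c := by
  rw [QtorusLin_apply, QtorusLin_apply]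
  congr 1
  unfold linQcov
  congr 1
  funext t
  refine Qcov_congr L hL (cornerSite L c.1) c.2 (fun x κ' hx _ => ?_) (fun _ _ _ _ => rfl)
  simp only [B9Eq315QTorus.perCfg_apply]
  rw [h (perSite (fineP L m) x, κ') (blockCoord_perSite_of_inBox L m c.1 c.2 x hx)]

/-- **`(Q(U)A)(c) = 0` WHEN `A` VANISHES ON THE FINE BONDS OF `B(c₋) ∪ B(c₊)`** — the field slot of the same locality (`QtorusLin_congr_local` against
`A′ := 0`, then linearity). [folklore] [cite: Balaban1985Averaging, (121)–(122) p.36; Balaban1985BackgroundPropagators, (3.15) p.393] -/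
theorem QtorusLin_eq_zero_of_vanish (A : Bond d (fineP L m) → 𝔸) (c : Bond d m)
    (h : ∀ b : Bond d (fineP L m), (blockCoord L m b.1 = c.1 ∨ blockCoord L m b.1 = shift c.2 c.1) → A b = 0) :
    QtorusLin L m hL U hα1 hU1 hreg A c = 0 := by
  rw [QtorusLin_congr_local L m hL U hα1 hU1 hreg (A' := 0) c (fun b hb => by rw [h b hb]; rfl), map_zero, Pi.zero_apply]

end Lin

/-! ## §3 On the weighted `L²` carriers: `Q(U)f = Q(Ũ)f` for `f` supported over the blocks of `Y`, `U = Ũ` over the 1-neighbourhood of `Y` -/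

section Carrier

variable {𝔸 : Type*} [NormedRing 𝔸] [NormedAlgebra ℂ 𝔸] [CompleteSpace 𝔸] [NormOneClass 𝔸] (hL : 1 ≤ L)
  {W : Type*} [NormedAddCommGroup W] [InnerProductSpace ℂ W] (φ : W ≃ₗ[ℂ] 𝔸) {c₀ : ℝ} {c₁ : ℝ}
  (U Ũ : Bond d (fineP L m) → 𝔸ˣ) {α α' : ℝ} (hα1 : α ≤ 1 / 64) (hα1' : α' ≤ 1 / 64)
  (hU1 : ∀ (x : B7Prop1Explicit.Site d) (κ : Fin d), perCfg (fineP L m) U x κ ∈ U1 𝔸)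
  (hreg : ∀ (y : TSite d m) (κ : Fin d) (r : Fin d → Fin L),
    ‖((Wcx L (perCfg (fineP L m) U) (cornerSite L y) κ (boxVec L r) : 𝔸ˣ) : 𝔸) - 1‖ ≤ α)
  (hU1' : ∀ (x : B7Prop1Explicit.Site d) (κ : Fin d), perCfg (fineP L m) Ũ x κ ∈ U1 𝔸)
  (hreg' : ∀ (y : TSite d m) (κ : Fin d) (r : Fin d → Fin L),
    ‖((Wcx L (perCfg (fineP L m) Ũ) (cornerSite L y) κ (boxVec L r) : 𝔸ˣ) : 𝔸) - 1‖ ≤ α')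

/-- **`Q(U)f = Q(Ũ)f` FOR `f` SUPPORTED OVER THE BLOCKS OF `Y` WHEN `U = Ũ` ON EVERY FINE BOND WHOSE BASE BLOCK IS WITHIN COARSE DISTANCE `1` OF `Y`**
((K8)'s agreement letter verbatim): at a coarse bond `c` with `c₋ ∈ Y` or `c₊ ∈ Y` both blocks `B(c₋)`, `B(c₊)` are within distance `1` of `Y` (§1); at any
other coarse bond `f` vanishes on both blocks and both sides are `0` (§2). [folklore]
[cite: Balaban1985BackgroundPropagators, (3.15) p.393, (3.83) p.407, Cor 3.6 p.408; Balaban1985Averaging, (121)–(122) p.36, p.24] -/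
theorem QtorusW_congr_of_support (hm : ∀ i, 1 ≤ m i) (Y : Set (TSite d m))
    (hUŨ : ∀ b : Bond d (fineP L m), (∃ y ∈ Y, tdist m y (blockCoord L m (bpos b)) ≤ 1) → U b = Ũ b)
    (f : BondL2K ℂ d (fineP L m) c₀ W) (hf : ∀ b : Bond d (fineP L m), blockCoord L m (bpos b) ∉ Y → WL2.equiv ℂ _ W f b = 0) :
    QtorusW L m hL φ U hα1 hU1 hreg (c₁ := c₁) f = QtorusW L m hL φ Ũ hα1' hU1' hreg' (c₁ := c₁) f := by
  apply (WL2.equiv ℂ (fun _ : Bond d m => c₁) W).injective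
  funext c
  rw [QtorusW_apply, QtorusW_apply]
  congr 1
  by_cases hc : c.1 ∈ Y ∨ shift c.2 c.1 ∈ Y
  · -- both blocks of `c` are within coarse distance `1` of `Y`
    refine QtorusLin_congr_of_background L m hL U Ũ hα1 hα1' hU1 hreg hU1' hreg' _ c fun b hb => hUŨ b ?_
    rcases hc with hY | hY
    · rcases hb with hb | hb
      · exact ⟨c.1, hY, by rw [show bpos b = b.1 from rfl, hb, tdist_self]; norm_num⟩
      · exact ⟨c.1, hY, by rw [show bpos b = b.1 from rfl, hb]; exact tdist_shift_le hm c.2 c.1⟩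
    · rcases hb with hb | hb
      · exact ⟨shift c.2 c.1, hY, by rw [show bpos b = b.1 from rfl, hb]; exact tdist_shift_le' hm c.2 c.1⟩
      · exact ⟨shift c.2 c.1, hY, by rw [show bpos b = b.1 from rfl, hb, tdist_self]; norm_num⟩
  · -- `f` vanishes on both blocks: both sides are `0`
    simp only [not_or] at hc
    have hv : ∀ b : Bond d (fineP L m), (blockCoord L m b.1 = c.1 ∨ blockCoord L m b.1 = shift c.2 c.1) →
        (fun b => φ (WL2.equiv ℂ _ W f b)) b = 0 := fun b hb => by
      have hb0 : WL2.equiv ℂ _ W f b = 0 := hf b (by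
        rcases hb with hb | hb
        · rw [show bpos b = b.1 from rfl, hb]; exact hc.1
        · rw [show bpos b = b.1 from rfl, hb]; exact hc.2)
      simp only [hb0, map_zero]
    rw [QtorusLin_eq_zero_of_vanish L m hL U hα1 hU1 hreg _ c hv, QtorusLin_eq_zero_of_vanish L m hL Ũ hα1' hU1' hreg' _ c hv]

/-- The norm form of §3 (the shape the `Q`-transfer letters consume). [folklore] [cite: Balaban1985BackgroundPropagators, (3.15) p.393, Cor 3.6 p.408] -/
theorem norm_QtorusW_congr_of_support [Fact (0 < c₁)] (hm : ∀ i, 1 ≤ m i) (Y : Set (TSite d m))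
    (hUŨ : ∀ b : Bond d (fineP L m), (∃ y ∈ Y, tdist m y (blockCoord L m (bpos b)) ≤ 1) → U b = Ũ b)
    (f : BondL2K ℂ d (fineP L m) c₀ W) (hf : ∀ b : Bond d (fineP L m), blockCoord L m (bpos b) ∉ Y → WL2.equiv ℂ _ W f b = 0) :
    ‖QtorusW L m hL φ U hα1 hU1 hreg (c₁ := c₁) f‖ = ‖QtorusW L m hL φ Ũ hα1' hU1' hreg' (c₁ := c₁) f‖ := by
  rw [QtorusW_congr_of_support L m hL φ U Ũ hα1 hα1' hU1 hreg hU1' hreg' hm Y hUŨ f hf]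

end Carrier

/-! ## §4 The `Q`-transfer letter of the per-cube gauge reduction: `‖√a·Q(Ũ)(R(g)A)‖ = ‖√a·Q(U)A‖` -/

section Transfer

variable {𝔸 : Type*} [NormedRing 𝔸] [NormedAlgebra ℂ 𝔸] [CompleteSpace 𝔸] [NormOneClass 𝔸] [NeZero L] (hL : 1 ≤ L)
  {W : Type*} [NormedAddCommGroup W] [InnerProductSpace ℂ W] (φ : W ≃ₗ[ℂ] 𝔸) {c₀ : ℝ} {c₁ : ℝ} [Fact (0 < c₁)]
  (U Ũ : Bond d (fineP L m) → 𝔸ˣ) (g : TSite d (fineP L m) → 𝔸ˣ) (hg : ∀ x, g x ∈ U1 𝔸)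
  (hAd : ∀ (x : TSite d (fineP L m)) (v v' : W), ⟪AdW φ (g x) v, AdW φ (g x) v'⟫_ℂ = ⟪v, v'⟫_ℂ)
  {α α' : ℝ} (hα1 : α ≤ 1 / 64) (hα1' : α' ≤ 1 / 64)
  (hU1 : ∀ (x : B7Prop1Explicit.Site d) (κ : Fin d), perCfg (fineP L m) U x κ ∈ U1 𝔸)
  (hreg : ∀ (y : TSite d m) (κ : Fin d) (r : Fin d → Fin L),
    ‖((Wcx L (perCfg (fineP L m) U) (cornerSite L y) κ (boxVec L r) : 𝔸ˣ) : 𝔸) - 1‖ ≤ α)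
  (hU1' : ∀ (x : B7Prop1Explicit.Site d) (κ : Fin d), perCfg (fineP L m) Ũ x κ ∈ U1 𝔸)
  (hreg' : ∀ (y : TSite d m) (κ : Fin d) (r : Fin d → Fin L),
    ‖((Wcx L (perCfg (fineP L m) Ũ) (cornerSite L y) κ (boxVec L r) : 𝔸ˣ) : 𝔸) - 1‖ ≤ α')

include hg hAd in
/-- **THE `Q`-TRANSFER LETTER `hQ` OF `B9Eq387CubeReductionSmallField.cube_estimate_of_gauge_reduction`, DISCHARGED**: for a bond field `A` supported over the
blocks of `Y`, `U^g = Ũ` on every fine bond whose base block is within coarse distance `1` of `Y`, `g(x) ∈ U1` with fibrewise-isometric `R(g(x))`: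
`‖√a·Q(Ũ)(R(g)A)‖ = ‖√a·Q(U)A‖` — (3.32) `Q(U^g)(R(g)A) = R(g₁)(Q(U)A)` (`QtorusW_gaugeU`, witnesses `hU1_gaugeU`∕`hreg_gaugeU`), §3 at `(U^g, Ũ)` (the gauged
field has the support of `A`), and `‖R(g₁)·‖ = ‖·‖`. [folklore] [cite: Balaban1985BackgroundPropagators, (3.32) p.396, (3.15) p.393, Cor 3.6 p.408; Balaban1985Averaging, (121)–(122) p.36] -/
theorem norm_QtorusW_gauge_transfer (hm : ∀ i, 1 ≤ m i) (Y : Set (TSite d m))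
    (hUŨ : ∀ b : Bond d (fineP L m), (∃ y ∈ Y, tdist m y (blockCoord L m (bpos b)) ≤ 1) → gaugeU g U b = Ũ b)
    (A : BondL2K ℂ d (fineP L m) c₀ W) (hA : ∀ b : Bond d (fineP L m), blockCoord L m (bpos b) ∉ Y → WL2.equiv ℂ _ W A b = 0) (a : ℝ) :
    ‖((Real.sqrt a : ℝ) : ℂ) • QtorusW L m hL φ Ũ hα1' hU1' hreg' (c₁ := c₁) (gaugeW φ (fun b : Bond d (fineP L m) => g (bpos b)) A)‖ =
      ‖((Real.sqrt a : ℝ) : ℂ) • QtorusW L m hL φ U hα1 hU1 hreg (c₁ := c₁) A‖ := by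
  -- the gauged field has the support of `A`
  have hAg : ∀ b : Bond d (fineP L m), blockCoord L m (bpos b) ∉ Y →
      WL2.equiv ℂ _ W (gaugeW φ (fun b : Bond d (fineP L m) => g (bpos b)) A) b = 0 := fun b hb => by
    rw [B9Eq328GaugeAction.equiv_gaugeW, hA b hb, map_zero]
  -- `Q(Ũ)(R(g)A) = Q(U^g)(R(g)A)` by §3 at `(U^g, Ũ)`, then (3.32) and the isometry
  rw [← QtorusW_congr_of_support L m hL φ (gaugeU g U) Ũ hα1 hα1' (hU1_gaugeU L m g U hg hU1) (hreg_gaugeU L m g U hg hreg) hU1' hreg' hm Y hUŨ _ hAg,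
    QtorusW_gaugeU L m g U hL φ hα1 hU1 hreg (hU1_gaugeU L m g U hg hU1) (hreg_gaugeU L m g U hg hreg) A, norm_smul, norm_smul,
    norm_gaugeW φ _ (fun c : Bond d m => hAd (centre L m (bpos c))) _]

end Transfer

end Literature.MathematicalPhysics.QuantumFieldTheory.Balaban1983to89.B9Eq383QTorusBackgroundLocality

end
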